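import Summits.AnomalousDissipation.AnomalousDissipation.Theorems.SawtoothPulseCascadeK1LocalisedCascadeKoopmanLeakage
import Summits.AnomalousDissipation.AnomalousDissipation.Theorems.SawtoothPulseCascadeK1LocalisedCascadeSlotPullback

/-!
# K1loc, line `Spectral` / SeqCone — helper: UN-GAUGING ONE FIBRE ON THE FLAT STRIPS (T1, first brick)

Helper file of the prover lane on the crux `K1LocalisedCascade` (stmt-AnomalousDissipation-19491), route
`SawtoothPulseCascade` (memo v4 §3 target T1 "half-slot step" = slot lemma ∘ per-fibre un-gauging).  After an H half-slot
the scalar is `w(t₁) = G ∘ Φ_γ⁻¹` with `G` the Lagrangian pull-back controlled by the slot lemma (`…SlotLemma`,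
`…SlotCascade`) and `Φ_γ⁻¹ = shearMap 0 1 (amp U γ)`.  On a fibre `{k₀ = n}` the un-gauging is multiplication by the phase
`twist (amp U γ) n (x₁)` (g0's `comp_shearMap_eq_mul_of_fibre`), and after localisation to the flat strips of one slope
by a cut-off `X(x₁)` it is an INTEGER frequency shift `b` along `e₁` times a smooth unimodular-bounded multiplier
`Θ = X(x₁)·twist(x₁)·e_b(x₁)` — exactly the input form `e_q · (Ξ · F)` of g0's two-branch / three-piece lemmas
(`…ShiftBookkeeping`): `ungauge_fibre_eq`, with `norm_ungaugeMultiplier_le`.  No definitions; no statement about the stub.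
[cite: Grafakos2014, Prop. 3.1.2 (5) (coefficients of products / modulations)] [problem: turb]
-/

-- `Summit.<Summit>.<Problem>`: single-conjunct summit, the duplicate namespace segment is deliberate.
set_option linter.dupNamespace false

noncomputable section

namespace Summit.AnomalousDissipation.AnomalousDissipation.Theorems.SawtoothPulseCascade.K1Slot

open MeasureTheory Set Filter Topology UnitAddTorus Function
open scoped ContDiff
open Literature.Analysis Literature.Analysis.FunctionSpaces Literature.Analysis.FunctionSpaces.Torus
open Literature.Analysis.FluidPDE.ShearStage

variable {d : Type*} [Fintype d] [DecidableEq d]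

/-- Opposite integer modulations along one axis cancel: `e_{-b eⱼ}(x) · e_{b eⱼ}(x) = 1`. [folklore] -/
theorem mFourier_single_neg_mul_self (j : d) (b : ℤ) (x : UnitAddTorus d) :
    mFourier (Pi.single j (-b)) x * mFourier (Pi.single j b) x = 1 := by
  rw [Torus.mFourier_single, Torus.mFourier_single, ← fourier_add, neg_add_cancel, fourier_zero]

/-- **Un-gauging one fibre on the flat strips.**  Let `G : T^d → ℂ` be smooth with all modes on the fibre `kᵢ = n`,
`Φ = shearMap i j P` a transversal shear (for the H half-pulse: `P = amp U γ`), `X` a cut-off profile read off `x_j`, and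
`b : ℤ` (the rounded shift `round(nγσ)` of the strip family).  Then
`X(x_j) · (G ∘ Φ)(x) = e_{(-b)eⱼ}(x) · (Θ(x) · G(x))` with the multiplier `Θ = X(x_j) · g_n(x_j) · e_{b eⱼ}(x)` — the
input form of the two-branch bookkeeping. [cite: Grafakos2014, Prop. 3.1.2 (5)] -/
theorem ungauge_fibre_eq {G : UnitAddTorus d → ℂ} {i : d} (hG : IsSmooth G) {n : ℤ}
    (hn : ∀ k, mFourierCoeff G k ≠ 0 → k i = n) (P X : ShearProfile) (j : d) (b : ℤ) :
    (fun x => (X.onCircle (x j) : ℂ) * (G ∘ shearMap i j P) x) =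
      fun x => mFourier (Pi.single j (-b)) x *
        (((X.onCircle (x j) : ℂ) * twist P n (x j) * mFourier (Pi.single j b) x) * G x) := by
  rw [SpectralLeakage.comp_shearMap_eq_mul_of_fibre hG hn P j]
  funext x
  have h1 := mFourier_single_neg_mul_self j b x
  calc (X.onCircle (x j) : ℂ) * (twist P n (x j) * G x)
      = (mFourier (Pi.single j (-b)) x * mFourier (Pi.single j b) x) * ((X.onCircle (x j) : ℂ) * (twist P n (x j) * G x)) := by
        rw [h1, one_mul]
    _ = _ := by ring

/-- The un-gauging multiplier is bounded by the cut-off: `‖Θ(x)‖ = |X(x_j)|` (the phase and the modulation are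
unimodular). [folklore] -/
theorem norm_ungaugeMultiplier_eq (P X : ShearProfile) (n : ℤ) (j : d) (b : ℤ) (x : UnitAddTorus d) :
    ‖(X.onCircle (x j) : ℂ) * twist P n (x j) * mFourier (Pi.single j b) x‖ = |X.onCircle (x j)| := by
  rw [norm_mul, norm_mul, norm_twist, Complex.norm_real, Real.norm_eq_abs, mul_one, Torus.mFourier_single]
  simp

/-- In particular `‖Θ‖ ≤ 1` when `|X| ≤ 1`. [folklore] -/
theorem norm_ungaugeMultiplier_le (P X : ShearProfile) (hX1 : ∀ y, |X y| ≤ 1) (n : ℤ) (j : d) (b : ℤ)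
    (x : UnitAddTorus d) : ‖(X.onCircle (x j) : ℂ) * twist P n (x j) * mFourier (Pi.single j b) x‖ ≤ 1 := by
  rw [norm_ungaugeMultiplier_eq]
  obtain ⟨y, rfl⟩ := proj_surjective x
  rw [proj_apply, ShearProfile.onCircle_coe]
  exact hX1 _

/-- The un-gauging multiplier is smooth on `T^d`. [folklore] -/
theorem isSmooth_ungaugeMultiplier (P X : ShearProfile) (n : ℤ) (j : d) (b : ℤ) :
    IsSmooth (fun x : UnitAddTorus d => (X.onCircle (x j) : ℂ) * twist P n (x j) * mFourier (Pi.single j b) x) := by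
  have hX : IsSmooth (fun x : UnitAddTorus d => ((X.onCircle (x j) : ℝ) : ℂ)) :=
    (isSmooth_onCircle_comp' X j).ofReal_comp
  have htw : IsSmooth (fun x : UnitAddTorus d => twist P n (x j)) := by
    -- `twist P n (x j) = e_{-n eᵢ?}` no: it is the composition of the smooth periodic `t ↦ exp(-2πi n P t)` with `x_j`
    have h : lift (fun x : UnitAddTorus d => twist P n (x j)) = fun y => Complex.exp (-(2 * Real.pi * Complex.I * n * P (y j))) := by
      funext y; rw [lift_apply, proj_apply, twist_coe]
    unfold IsSmooth
    rw [h]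
    refine Complex.contDiff_exp.comp ?_
    have hP : ContDiff ℝ ∞ (fun y : EuclideanSpace ℝ d => ((P (y j) : ℝ) : ℂ)) :=
      Complex.ofRealCLM.contDiff.comp (P.contDiff.comp (EuclideanSpace.proj j : EuclideanSpace ℝ d →L[ℝ] ℝ).contDiff)
    exact (contDiff_const.mul hP).neg
  exact (hX.mul htw).mul (isSmooth_mFourier _)

end Summit.AnomalousDissipation.AnomalousDissipation.Theorems.SawtoothPulseCascade.K1Slot
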